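import Mathlib
import Summits.Ventures.PercRepro2.K5HyperK3CmpB

/-!
# THE `TvT-TRI` CERTIFICATES OF THE CRUX KERNEL AT THE COINCIDENCE `o = b` (marking `b = 0`) IN BASE `2^25`, PART D
(blind cell PercRepro2, typer-1 g11; mine-1 §23.12 at the three `MarksDistinct` markings; twin `k5hyper_k3cmp_b_typer.py 0`)

`CertLE5 (kNegTvT35b 0 x y z) (kPosTvT35b 0 x y z)`: `N(K₅ + △(1,1,1)) ≥ N(K₅ + T(1))` for the (TRI) kernel `K₃` at the
marking `(0, 1, 2, 3, 0)`, every `K₅` profile (`600` products of three base-`2^25` Kronecker numbers; one big triangle per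
file, `maxHeartbeats 0`).
-/

namespace Summit.Ventures.PercRepro2

namespace K5

set_option maxRecDepth 100000 in
set_option maxHeartbeats 0 in
/-- `TvT-TRI ≥ 0` at the marking `b = 0` on the triangle `T = {0, 2, 3}` (base `2^25`). -/
theorem cert_TvT35b0_023 : CertLE5 (kNegTvT35b 0 0 2 3) (kPosTvT35b 0 0 2 3) := by
  unfold CertLE5
  decide +kernel

end K5

end Summit.Ventures.PercRepro2
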